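import Summits.QuantumFields.YangMills.Theorems.UnitScaleTiltProp7SymAvgRelativeBound
import Literature.MathematicalPhysics.QuantumFieldTheory.Balaban1983to89.T3PrintedRegularMinimiser
import HarnessLib

/-!
# Route `UnitScaleTilt`, crux K1 child «MinimiserStabilityRegPr» (stmt-QuantumFields-19200), stub `stub_existenceMinimalOrbit` (EX), route (α), node (AVG-SYM) —
# (AVG-SYM-BD) AT THE ROUTE's T³ MEMBERS: `Prop7SymAvgRelativeBound.norm_relIter_sub_one_le_of_plaqSmall` read at `P := F.P K`, `k := K − n`, `η := L^{−(K−n)}`,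
# with the budget DISCHARGED from the printed-regular plaquette window `RegPr` ((6)/(14): `|U₀(∂p) − 1| < ε₀L^{−2(K−n)}`) and two absolute smallness rows

Cell `ym3-torus`, width seat `ym-ust-20520-w4` (gen 2; OWNER ym3-torus-plan g25 02:47:05Z (AVG-SYM-BD)).  YM₃ on T³ is a ladder rung (R3), NOT the Clay problem; nothing
here is a claim about the stub, the crux, d = 4 or the mass gap.  `--supports stmt-QuantumFields-19200 --as helper`; count-neutral.

WHAT THIS FILE PROVES (sorry-free; no definition; arithmetic over the parent file).
**`norm_relIter_sub_one_le_T3`** — for a member `(F, n, K)`, `n < K`, a background `U₀ : GaugeField (F.P K) 0 SU(2)` in the printed-regular class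
`RegPr F n K ε₀ U₀` with `10⁷·L³·ε₀ ≤ 1`, and a complex perturbation `A : PBond (F.P K) 0 → M₂(ℂ)` of sup size `‖A(b)‖ ≤ r` with `10⁶·L²·r ≤ 1`, at `η := L^{−(K−n)}`:
for EVERY top bond `e : PBond (F.P K) (K − n)`,
`‖Ū^{(K−n)}[e^{iηA}·U₀♭](e) · (Ū^{(K−n)}[U₀♭](e))⁻¹ − 1‖ ≤ 600·L·(3r + 18ε₀)` — NO dependence on `K − n` (the height), `n`, `F.m`: the k-UNIFORM (BD) input
for `Chart47T3sym` in the route's letters.  The parent's budget `6400ℓ²Lᵏs₀ ≤ 1` and the conversion `Lᵏs₀ ≤ 3r + 18ε₀` (`Lᵏ·ηr = r`, `L^{2k}·ε₀L^{−2k} = ε₀`,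
`s_B = 6(3Lᵏ − 1)ε₀L^{−2k} ≤ 18ε₀L^{−k}`) are the only content.
HONEST SCOPE.  Arithmetic; every estimate is the `Prop8Chart*` ∕ `IterPlaqSmallAllL` lineage's via the parent file.

References: T. Bałaban, CMP **102** (1985) 277–309 [Balaban1985Variational] ((6) p.278, (14) p.280, (44) p.285); CMP **98** (1985) 17–51 [Balaban1985Averaging]
(Prop. 4 (134)–(135) p.38); CMP **109** (1987) 249–301 [Balaban1987RG1] ((0.4)–(0.11) p.253).
-/

noncomputable section

open scoped BigOperators Matrix.Norms.L2Operator
open NormedSpace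

namespace Summit.QuantumFields.YangMills.Theorems.Prop7SymAvgRelativeBound

open Literature.MathematicalPhysics.QuantumFieldTheory.Balaban1983to89
open Literature.MathematicalPhysics.QuantumFieldTheory.Balaban1983to89.T3ContinuumYM3Torus
open T3RegularMinimiser (regThreshold)
open T3PrintedRegularMinimiser (RegPr)
open T4Continuum
open B10Eq27TorusAxialLog (unitsField toUField)
open Summit.QuantumFields.YangMills.Theorems.Prop8Chart (expCfg emlIterU)

/-- **(AVG-SYM-BD) AT THE T³ MEMBERS** — `‖Ū^{(K−n)}[e^{iηA}U₀♭](e)·(Ū^{(K−n)}[U₀♭](e))⁻¹ − 1‖ ≤ 600L(3r + 18ε₀)` for `RegPr F n K ε₀ U₀`, `10⁷L³ε₀ ≤ 1`,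
`‖A(b)‖ ≤ r`, `10⁶L²r ≤ 1`, `η = L^{−(K−n)}`, every top bond `e`; uniform in the height `K − n`. [cite: Balaban1985Averaging, Prop. 4 (134)-(135) p.38; Balaban1985Variational, (6) p.278, (44) p.285] -/
theorem norm_relIter_sub_one_le_T3 (F : T3Family) (n K : ℕ) (hnK : n < K) {ε₀ : ℝ} (hε₀ : 0 < ε₀) (hε : 10 ^ 7 * (F.L : ℝ) ^ 3 * ε₀ ≤ 1)
    (U₀ : GaugeField (F.P K) 0 (Matrix.specialUnitaryGroup (Fin 2) ℂ)) (hreg : RegPr F n K ε₀ U₀)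
    (A : PBond (F.P K) 0 → Matrix (Fin 2) (Fin 2) ℂ) {r : ℝ} (hr0 : 0 ≤ r) (hr : 10 ^ 6 * (F.L : ℝ) ^ 2 * r ≤ 1) (hA : ∀ b, ‖A b‖ ≤ r)
    (e : PBond (F.P K) (K - n)) :
    ‖((emlIterU (K - n) (fun b => expCfg (((F.L : ℝ)⁻¹) ^ (K - n)) A b * unitsField (toUField U₀) b) e : (Matrix (Fin 2) (Fin 2) ℂ)ˣ) : Matrix (Fin 2) (Fin 2) ℂ) *
        (((emlIterU (K - n) (unitsField (toUField U₀)) e)⁻¹ : (Matrix (Fin 2) (Fin 2) ℂ)ˣ) : Matrix (Fin 2) (Fin 2) ℂ) - 1‖ ≤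
      600 * (F.L : ℝ) * (3 * r + 18 * ε₀) := by
  -- letters
  have hd : (F.P K).d = 3 := T3Family.P_d F K
  have hLL : ((F.P K).L : ℝ) = F.L := rfl
  have hL3 : 3 ≤ F.L := by obtain ⟨a, ha⟩ := F.hL.1; have := F.hL.2; omega
  have hL3r : (3 : ℝ) ≤ F.L := by exact_mod_cast hL3
  have hL0 : (0 : ℝ) < F.L := by linarith
  have hL1 : (1 : ℝ) ≤ F.L := by linarith
  -- the height as a letter `k` (the goal and `e` only see `K − n` through it)
  generalize hk : K - n = k at e ⊢
  have hk1 : k + 1 ≤ (F.P K).m + (F.P K).K := by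
    show k + 1 ≤ F.m + K; have := F.hm; omega
  set X : ℝ := (F.L : ℝ) ^ k with hX
  have hX1 : 1 ≤ X := one_le_pow₀ hL1
  have hX0 : 0 < X := by positivity
  set η : ℝ := ((F.L : ℝ)⁻¹) ^ k with hη
  have hη0 : 0 < η := by positivity
  have hXη : X * η = 1 := by rw [hX, hη, inv_pow, mul_inv_cancel₀ (pow_ne_zero _ hL0.ne')]
  have hη1 : η ≤ 1 := by
    have : η = X⁻¹ := by rw [hη, hX, inv_pow]
    rw [this]; exact inv_le_one_of_one_le₀ hX1
  -- the plaquette window of `RegPr`: `a₀ = ε₀L^{−2k}`, `X²a₀ = ε₀`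
  set a₀ : ℝ := regThreshold F n K ε₀ with ha₀
  have ha₀0 : 0 < a₀ := by rw [ha₀]; unfold regThreshold; positivity
  have hXa : X * (X * a₀) = ε₀ := by
    have hX2 : X * X = (F.L : ℝ) ^ (2 * k) := by rw [hX, ← pow_add, two_mul]
    have ha : a₀ = ε₀ * ((F.L : ℝ) ^ (2 * k))⁻¹ := by rw [ha₀]; unfold regThreshold; rw [hk, inv_pow]
    rw [← mul_assoc, hX2, ha, mul_comm ε₀, ← mul_assoc, mul_inv_cancel₀ (pow_ne_zero _ hL0.ne'), one_mul]
  have hU : PlaqSmall a₀ U₀ := hreg.1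
  -- the perturbation's reads: `‖ηA(b)‖ ≤ t := ηr ≤ 1`
  set t : ℝ := η * r with ht
  have ht0 : 0 ≤ t := by positivity
  have hr1 : r ≤ 1 := by
    have hL2 : (1 : ℝ) ≤ (F.L : ℝ) ^ 2 := one_le_pow₀ hL1
    have h1 : (1 : ℝ) ≤ 10 ^ 6 * (F.L : ℝ) ^ 2 := by linarith
    have h2 : 1 * r ≤ 10 ^ 6 * (F.L : ℝ) ^ 2 * r := mul_le_mul_of_nonneg_right h1 hr0
    linarith
  have ht1 : t ≤ 1 := by rw [ht]; exact mul_le_one₀ hη1 hr0 hr1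
  have hA' : ∀ b, ‖(η : ℂ) • A b‖ ≤ t := fun b => by
    rw [norm_smul, Complex.norm_real, Real.norm_of_nonneg hη0.le, ht]
    exact mul_le_mul_of_nonneg_left (hA b) hη0.le
  have hXt : X * t = r := by rw [ht, ← mul_assoc, hXη, one_mul]
  -- `s_B = 2·3·(3X − 1)·a₀ ≤ 18·X·a₀`, `X·s_B ≤ 18ε₀`, `s_B ≤ ½`
  set sB : ℝ := 2 * (((F.P K).d : ℝ) * (3 * ((F.P K).L : ℝ) ^ k - 1)) * a₀ with hsB
  have hsB' : sB = 6 * (3 * X - 1) * a₀ := by rw [hsB, hd, hLL, ← hX]; push_cast; ring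
  have h3X : (0 : ℝ) ≤ 3 * X - 1 := by linarith
  have hsB0 : 0 ≤ sB := by rw [hsB']; exact mul_nonneg (mul_nonneg (by norm_num) h3X) ha₀0.le
  have hXsB : X * sB ≤ 18 * ε₀ := by
    have e1 : X * sB = 18 * (X * (X * a₀)) - 6 * (X * a₀) := by rw [hsB']; ring
    rw [e1, hXa]
    linarith [mul_nonneg hX0.le ha₀0.le]
  have hε1 : ε₀ ≤ 1 / 10 ^ 7 := by
    have h1 : (1 : ℝ) ≤ (F.L : ℝ) ^ 3 := one_le_pow₀ hL1
    have h2 : 10 ^ 7 * ε₀ * 1 ≤ 10 ^ 7 * ε₀ * (F.L : ℝ) ^ 3 := mul_le_mul_of_nonneg_left h1 (by positivity)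
    have h3 : 10 ^ 7 * ε₀ * (F.L : ℝ) ^ 3 = 10 ^ 7 * (F.L : ℝ) ^ 3 * ε₀ := by ring
    rw [le_div_iff₀ (by norm_num)]; linarith
  have hsB1 : sB ≤ 1 / 2 := by
    have : sB ≤ X * sB := le_mul_of_one_le_left hsB0 hX1
    linarith
  -- the parent's `s₀` and its budget
  set s₀ : ℝ := 2 * t * (1 + sB) + sB with hs₀
  have hXs₀ : X * s₀ ≤ 3 * r + 18 * ε₀ := by
    have h1 : X * s₀ = 2 * (X * t) * (1 + sB) + X * sB := by rw [hs₀]; ring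
    rw [h1, hXt]
    have h2 : 2 * r * sB ≤ 2 * r * (1 / 2) := mul_le_mul_of_nonneg_left hsB1 (by positivity)
    have h3 : 2 * r * (1 + sB) = 2 * r + 2 * r * sB := by ring
    linarith
  have hℓ : ((((F.P K).d + 2) * (F.P K).L : ℕ) : ℝ) = 5 * (F.L : ℝ) := by
    have hN : ((F.P K).d + 2) * (F.P K).L = 5 * F.L := by rw [hd]; rfl
    rw [hN]; push_cast; ring
  have hbudget : 6400 * ((((F.P K).d + 2) * (F.P K).L : ℕ) : ℝ) ^ 2 * ((F.P K).L : ℝ) ^ k *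
      (2 * t * (1 + 2 * (((F.P K).d : ℝ) * (3 * ((F.P K).L : ℝ) ^ k - 1)) * a₀) + 2 * (((F.P K).d : ℝ) * (3 * ((F.P K).L : ℝ) ^ k - 1)) * a₀) ≤ 1 := by
    rw [← hsB, ← hs₀, hℓ, hLL, ← hX]
    have hr' : (F.L : ℝ) ^ 2 * r ≤ 1 / 10 ^ 6 := by rw [le_div_iff₀ (by norm_num)]; linarith
    have h2 : (F.L : ℝ) ^ 2 * ε₀ ≤ 1 / 10 ^ 7 := by
      have h23 : (F.L : ℝ) ^ 2 * ε₀ ≤ (F.L : ℝ) ^ 3 * ε₀ := mul_le_mul_of_nonneg_right (pow_le_pow_right₀ hL1 (by norm_num)) hε₀.le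
      rw [le_div_iff₀ (by norm_num)]; linarith
    calc 6400 * (5 * (F.L : ℝ)) ^ 2 * X * s₀ = 160000 * (F.L : ℝ) ^ 2 * (X * s₀) := by ring
      _ ≤ 160000 * (F.L : ℝ) ^ 2 * (3 * r + 18 * ε₀) := mul_le_mul_of_nonneg_left hXs₀ (by positivity)
      _ = 480000 * ((F.L : ℝ) ^ 2 * r) + 2880000 * ((F.L : ℝ) ^ 2 * ε₀) := by ring
      _ ≤ 480000 * (1 / 10 ^ 6) + 2880000 * (1 / 10 ^ 7) :=
          add_le_add (mul_le_mul_of_nonneg_left hr' (by norm_num)) (mul_le_mul_of_nonneg_left h2 (by norm_num))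
      _ ≤ 1 := by norm_num
  -- the parent theorem at `P := F.P K`, `k := K − n`
  have h := norm_relIter_sub_one_le_of_plaqSmall hk1 U₀ ha₀0 hU η A ht1 hA' hbudget e
  have hfin : 120 * ((((F.P K).d + 2) * (F.P K).L : ℕ) : ℝ) * ((F.P K).L : ℝ) ^ k *
      (2 * t * (1 + 2 * (((F.P K).d : ℝ) * (3 * ((F.P K).L : ℝ) ^ k - 1)) * a₀) + 2 * (((F.P K).d : ℝ) * (3 * ((F.P K).L : ℝ) ^ k - 1)) * a₀) ≤
      600 * (F.L : ℝ) * (3 * r + 18 * ε₀) := by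
    rw [← hsB, ← hs₀, hℓ, hLL, ← hX]
    calc 120 * (5 * (F.L : ℝ)) * X * s₀ = 600 * (F.L : ℝ) * (X * s₀) := by ring
      _ ≤ 600 * (F.L : ℝ) * (3 * r + 18 * ε₀) := mul_le_mul_of_nonneg_left hXs₀ (by positivity)
  exact h.trans hfin

end Summit.QuantumFields.YangMills.Theorems.Prop7SymAvgRelativeBound

end
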